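import Mathlib
import HarnessLib
import Summits.Ventures.LatticeQCDFlow.Exactness.JarzynskiEstimatorBias
import Summits.Ventures.LatticeQCDFlow.Exactness.NCMCGeneralSpaceDissipation

/-!
# The finite-sample Jarzynski estimator on a general state space: non-negative bias, decreasing in the sample size

HONEST FRAMING: exact (Metropolis-corrected) sampling algorithms for lattice gauge theory;
figures of merit are autocorrelation/cost numbers at stated couplings and volumes; no
continuum-physics claim.

Venture `LatticeQCDFlow` (cell pub-lqcd), topic `Exactness`; FANOUT row 13 (`eng-snf`, GEN-11).
NEW WORK of the cell (elementary: Jensen for `exp` / `log` on product laws, the leave-one-out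
identity, marginalisation along `Fin.removeNth`), not a published result; nothing is cited as a fact
(the printed observation that the estimator's systematic error is positive and falls with `N` —
D. M. Zuckerman, T. B. Woolf, Phys. Rev. Lett. 89 (2002) 180602; J. Gore, F. Ritort, C. Bustamante,
PNAS 100 (2003) 12564 — is named only).  General-state-space counterpart of the finite
`Exactness/JarzynskiEstimatorBias.lean` (outcomes in a `Fintype`, laws as finite sums), whose
vocabulary `sampleMean` / `jarzynskiEstimate` / `sampleMean_eq_avg_leaveOneOut` is reused verbatim;
it was the item "the general-space Jarzynski ESTIMATOR bias (`Measure.pi`, leave-one-out)" of the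
GEN-10 NOT-TYPED list.

## Setting and content

A probability law `μ` on a measurable space of records `E` (think `μ = P_F = fwdPathLaw ν₀ κF`) and a
positive measurable weight `w : E → ℝ` (think `w = e^{−W}`, so `E_μ[w] = e^{−ΔF}` by Jarzynski);
`N` i.i.d. records have the product law `Measure.pi (fun _ : Fin N => μ)` on `Fin N → E`; the
estimate from them is `jarzynskiEstimate w y = −log ((1/N) Σ_i w (y i))`.

* `integral_comp_eval_pi`, `integral_comp_removeNth_pi` — marginalisation: a function of one
  coordinate integrates to its `μ`-mean (`measurePreserving_eval`); a function of the coordinates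
  other than `j` integrates against the `(N+1)`-sample law to its `N`-sample mean
  (`removeNth j` = `snd ∘ piFinSuccAbove j` is measure preserving, `measurePreserving_removeNth_pi`).
* `integrable_sampleMean_pi`, `integral_sampleMean_pi` — `E[(1/N) Σ_i w(y i)] = E_μ[w]` (`N ≥ 1`).
* **`neg_log_integral_le_integral_jarzynskiEstimate`** — NON-NEGATIVE BIAS: for `N ≥ 1`,
  `−log E_μ[w] ≤ E[−log ((1/N) Σ_i w_i)]` whenever `log` of the sample mean is integrable (Jensen for
  the convex `exp` applied to that logarithm; with Mathlib's conventions a non-integrable logarithm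
  would make the right side read `0`, hence the hypothesis).
* **`integral_jarzynskiEstimate_succ_le`** — THE BIAS DECREASES WITH `N`: `E[ΔF̂_{N+1}] ≤ E[ΔF̂_N]`
  (`N ≥ 1`; concavity of `log` on the leave-one-out average, then marginalisation of each
  leave-one-out term); `integral_jarzynskiEstimate_antitone` (`E[ΔF̂_M] ≤ E[ΔF̂_N]`, `1 ≤ N ≤ M`);
  `jackknife_integral_le` — the delete-one jackknife expectation
  `(N+1)·E[ΔF̂_{N+1}] − N·E[ΔF̂_N]` is `≤ E[ΔF̂_{N+1}]` (the correction acts against the bias).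
* **`CrooksPair.freeEnergyDiff_le_integral_jarzynskiEstimate`** — for EVERY Crooks pair on a general
  measurable state space (adjoint stochastic steps, Jacobian-charged layers, concatenations) and every
  `N ≥ 1`: `ΔF ≤ E_{P_F^{⊗N}}[−log ((1/N) Σ_i e^{−W_i})]` — `snf.estimators.free_energy`'s `dF` from
  `N` independent evolutions over-estimates `ΔF` on average, by less for larger `N`
  (`CrooksPair.integral_jarzynskiEstimate_succ_le`).

Scope: i.i.d. evolutions (iid-exact priors, or replica starts treated as independent); correlated
chain starts (the engine's BLOCK jackknife) are not covered.  Nothing is claimed about the SIZE of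
the bias for a concrete protocol.
-/

namespace Summit.Ventures.LatticeQCDFlow.Exactness.GeneralNCMC

open MeasureTheory ProbabilityTheory Set Filter Finset
open scoped ENNReal

variable {E : Type*} [MeasurableSpace E]

/-! ## Marginalisation under the product law -/

/-- Integration against a measure-preserving (not necessarily injective) map. -/
theorem integral_comp_of_measurePreserving {α β : Type*} [MeasurableSpace α] [MeasurableSpace β]
    {μ : Measure α} {ν : Measure β} {f : α → β} (hf : MeasurePreserving f μ ν) {g : β → ℝ}
    (hg : AEStronglyMeasurable g ν) : ∫ x, g (f x) ∂μ = ∫ y, g y ∂ν := by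
  calc ∫ x, g (f x) ∂μ = ∫ y, g y ∂(μ.map f) :=
        (integral_map hf.measurable.aemeasurable (by rw [hf.map_eq]; exact hg)).symm
    _ = ∫ y, g y ∂ν := by rw [hf.map_eq]

/-- A function of ONE coordinate integrates against the `N`-sample law to its `μ`-mean. -/
theorem integral_comp_eval_pi (μ : Measure E) [IsProbabilityMeasure μ] {N : ℕ} (k : Fin N)
    {g : E → ℝ} (hg : AEStronglyMeasurable g μ) :
    ∫ y, g (y k) ∂(Measure.pi fun _ : Fin N => μ) = ∫ a, g a ∂μ :=
  integral_comp_of_measurePreserving (measurePreserving_eval (fun _ : Fin N => μ) k) hg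

/-- **Dropping coordinate `j` maps the `(N+1)`-sample law to the `N`-sample law**
(`removeNth j = snd ∘ piFinSuccAbove j`; Mathlib's `measurePreserving_piFinSuccAbove` and
`measurePreserving_snd`). -/
theorem measurePreserving_removeNth_pi (μ : Measure E) [IsProbabilityMeasure μ] {N : ℕ}
    (j : Fin (N + 1)) :
    MeasurePreserving (Fin.removeNth (α := fun _ => E) j) (Measure.pi fun _ : Fin (N + 1) => μ)
      (Measure.pi fun _ : Fin N => μ) := by
  have h1 := measurePreserving_piFinSuccAbove (fun _ : Fin (N + 1) => μ) j
  have h2 : MeasurePreserving (Prod.snd : E × (Fin N → E) → Fin N → E)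
      (μ.prod (Measure.pi fun _ : Fin N => μ)) (Measure.pi fun _ : Fin N => μ) :=
    measurePreserving_snd
  have h3 := h2.comp h1
  have hfun : (Prod.snd ∘ ⇑(MeasurableEquiv.piFinSuccAbove (fun _ : Fin (N + 1) => E) j)) =
      Fin.removeNth (α := fun _ => E) j := by
    funext y
    rfl
  rwa [hfun] at h3

/-- **Marginalisation**: a function of the coordinates other than `j` integrates against the
`(N+1)`-sample law to its `N`-sample mean. -/
theorem integral_comp_removeNth_pi (μ : Measure E) [IsProbabilityMeasure μ] {N : ℕ}
    (j : Fin (N + 1)) {F : (Fin N → E) → ℝ}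
    (hF : AEStronglyMeasurable F (Measure.pi fun _ : Fin N => μ)) :
    ∫ y, F (j.removeNth y) ∂(Measure.pi fun _ : Fin (N + 1) => μ) =
      ∫ z, F z ∂(Measure.pi fun _ : Fin N => μ) :=
  integral_comp_of_measurePreserving (measurePreserving_removeNth_pi μ j) hF

/-! ## The sample mean and the estimate: measurability, integrability, expectation -/

/-- The sample mean of a measurable weight is measurable on `N`-samples. -/
theorem measurable_sampleMean {w : E → ℝ} (hw : Measurable w) (N : ℕ) :
    Measurable fun y : Fin N → E => sampleMean w y := by
  unfold sampleMean
  exact (Finset.measurable_sum _ fun i _ => hw.comp (measurable_pi_apply i)).div_const _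

/-- The Jarzynski estimate of a measurable weight is measurable on `N`-samples. -/
theorem measurable_jarzynskiEstimate {w : E → ℝ} (hw : Measurable w) (N : ℕ) :
    Measurable fun y : Fin N → E => jarzynskiEstimate w y := by
  unfold jarzynskiEstimate
  exact (Real.measurable_log.comp (measurable_sampleMean hw N)).neg

/-- The sample mean of an integrable weight is integrable under the `N`-sample law. -/
theorem integrable_sampleMean_pi (μ : Measure E) [IsProbabilityMeasure μ] {w : E → ℝ}
    (hw : Integrable w μ) (N : ℕ) :
    Integrable (fun y : Fin N → E => sampleMean w y) (Measure.pi fun _ : Fin N => μ) := by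
  unfold sampleMean
  refine Integrable.div_const (integrable_finsetSum _ fun i _ => ?_) _
  exact (measurePreserving_eval (fun _ : Fin N => μ) i).integrable_comp_of_integrable hw

/-- **`E[(1/N) Σ_i w(y i)] = E_μ[w]`** for `N ≥ 1` i.i.d. records. -/
theorem integral_sampleMean_pi (μ : Measure E) [IsProbabilityMeasure μ] {w : E → ℝ}
    (hw : Integrable w μ) {N : ℕ} (hN : 0 < N) :
    ∫ y, sampleMean w y ∂(Measure.pi fun _ : Fin N => μ) = ∫ a, w a ∂μ := by
  unfold sampleMean
  have hI : ∀ i ∈ (univ : Finset (Fin N)),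
      Integrable (fun y : Fin N → E => w (y i)) (Measure.pi fun _ : Fin N => μ) :=
    fun i _ => (measurePreserving_eval (fun _ : Fin N => μ) i).integrable_comp_of_integrable hw
  have hN' : (N : ℝ) ≠ 0 := by exact_mod_cast hN.ne'
  rw [integral_div, integral_finsetSum _ hI]
  simp_rw [integral_comp_eval_pi μ _ hw.aestronglyMeasurable]
  rw [sum_const, card_univ, Fintype.card_fin, nsmul_eq_mul]
  field_simp

/-! ## Non-negative bias -/

/-- **The finite-sample Jarzynski estimate over-estimates on average.**  For a probability law `μ`
on records, a positive measurable `μ`-integrable weight `w`, and `N ≥ 1` i.i.d. records: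
`−log E_μ[w] ≤ E[−log ((1/N) Σ_i w(y i))]`, provided the logarithm of the sample mean is integrable
under the `N`-sample law.  (Jensen: `exp (E[log m]) ≤ E[m] = E_μ[w]`.) -/
theorem neg_log_integral_le_integral_jarzynskiEstimate (μ : Measure E) [IsProbabilityMeasure μ]
    {w : E → ℝ} (hwpos : ∀ a, 0 < w a) (hw : Integrable w μ) {N : ℕ}
    (hN : 0 < N)
    (hlog : Integrable (fun y : Fin N → E => Real.log (sampleMean w y)) (Measure.pi fun _ : Fin N => μ)) :
    -Real.log (∫ a, w a ∂μ) ≤ ∫ y, jarzynskiEstimate w y ∂(Measure.pi fun _ : Fin N => μ) := by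
  set π := Measure.pi fun _ : Fin N => μ with hπ
  have hsm := integrable_sampleMean_pi μ hw N
  -- `exp ∘ log ∘ sampleMean = sampleMean` (positive sample means)
  have hexp : (Real.exp ∘ fun y : Fin N → E => Real.log (sampleMean w y)) =
      fun y => sampleMean w y := by
    funext y
    simp only [Function.comp_apply]
    exact Real.exp_log (sampleMean_pos hwpos hN y)
  have hgi : Integrable (Real.exp ∘ fun y : Fin N → E => Real.log (sampleMean w y)) π := by
    rw [hexp]
    exact hsm
  have hj := convexOn_exp.map_integral_le Real.continuous_exp.continuousOn isClosed_univ
    (Eventually.of_forall fun x => mem_univ _) hlog hgi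
  have hrhs : ∫ y, Real.exp (Real.log (sampleMean w y)) ∂π = ∫ y, sampleMean w y ∂π :=
    integral_congr_ae (Eventually.of_forall fun y => Real.exp_log (sampleMean_pos hwpos hN y))
  rw [hrhs, hπ, integral_sampleMean_pi μ hw hN] at hj
  have hpos : 0 < ∫ a, w a ∂μ := lt_of_lt_of_le (Real.exp_pos _) hj
  have hle : ∫ y, Real.log (sampleMean w y) ∂π ≤ Real.log (∫ a, w a ∂μ) :=
    (Real.le_log_iff_exp_le hpos).2 hj
  unfold jarzynskiEstimate
  rw [integral_neg]
  linarith

/-! ## The bias decreases with the sample size -/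

omit [MeasurableSpace E] in
/-- Pointwise: the `(N+1)`-sample estimate is at most the average of the `N+1` leave-one-out
`N`-sample estimates (`log` concave on the leave-one-out identity `sampleMean_eq_avg_leaveOneOut`). -/
theorem jarzynskiEstimate_le_avg_leaveOneOut {w : E → ℝ} (hwpos : ∀ a, 0 < w a) {N : ℕ}
    (hN : 0 < N) (y : Fin (N + 1) → E) :
    jarzynskiEstimate w y ≤
      (∑ j : Fin (N + 1), jarzynskiEstimate w (j.removeNth y)) / (N + 1 : ℕ) := by
  unfold jarzynskiEstimate
  have hj := (strictConcaveOn_log_Ioi.concaveOn).le_map_sum (t := (univ : Finset (Fin (N + 1))))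
    (w := fun _ => ((N + 1 : ℕ) : ℝ)⁻¹) (p := fun j => sampleMean w (j.removeNth y))
    (fun _ _ => by positivity)
    (by rw [sum_const, card_univ, Fintype.card_fin, nsmul_eq_mul]; field_simp)
    (fun j _ => sampleMean_pos hwpos hN _)
  simp only [smul_eq_mul] at hj
  have hsum : ∑ j : Fin (N + 1), ((N + 1 : ℕ) : ℝ)⁻¹ * sampleMean w (j.removeNth y) =
      sampleMean w y := by
    rw [← mul_sum, inv_mul_eq_div, ← sampleMean_eq_avg_leaveOneOut w hN y]
  rw [hsum, ← mul_sum, inv_mul_eq_div] at hj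
  rw [sum_neg_distrib, neg_div]
  exact neg_le_neg hj

/-- **Monotonicity of the bias.**  For `N ≥ 1` i.i.d. records with a positive measurable weight,
`E[ΔF̂_{N+1}] ≤ E[ΔF̂_N]` (logarithms of the sample means integrable under both laws): one more
evolution can only lower the expected estimate, towards `−log E_μ[w]`. -/
theorem integral_jarzynskiEstimate_succ_le (μ : Measure E) [IsProbabilityMeasure μ] {w : E → ℝ}
    (hwm : Measurable w) (hwpos : ∀ a, 0 < w a) {N : ℕ} (hN : 0 < N)
    (hlogN : Integrable (fun y : Fin N → E => Real.log (sampleMean w y)) (Measure.pi fun _ : Fin N => μ))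
    (hlogS : Integrable (fun y : Fin (N + 1) → E => Real.log (sampleMean w y))
      (Measure.pi fun _ : Fin (N + 1) => μ)) :
    ∫ y, jarzynskiEstimate w y ∂(Measure.pi fun _ : Fin (N + 1) => μ) ≤
      ∫ z, jarzynskiEstimate w z ∂(Measure.pi fun _ : Fin N => μ) := by
  set πS := Measure.pi fun _ : Fin (N + 1) => μ with hπS
  set πN := Measure.pi fun _ : Fin N => μ with hπN
  have hN1 : ((N + 1 : ℕ) : ℝ) ≠ 0 := by exact_mod_cast Nat.succ_ne_zero N
  -- integrability of the estimates
  have hestN : Integrable (fun z : Fin N → E => jarzynskiEstimate w z) πN := hlogN.neg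
  have hestS : Integrable (fun y : Fin (N + 1) → E => jarzynskiEstimate w y) πS := hlogS.neg
  have hI : ∀ j ∈ (univ : Finset (Fin (N + 1))),
      Integrable (fun y : Fin (N + 1) → E => jarzynskiEstimate w (j.removeNth y)) πS :=
    fun j _ => (measurePreserving_removeNth_pi μ j).integrable_comp_of_integrable hestN
  have hRHS : Integrable
      (fun y : Fin (N + 1) → E => (∑ j : Fin (N + 1), jarzynskiEstimate w (j.removeNth y)) / (N + 1 : ℕ))
      πS := (integrable_finsetSum _ hI).div_const _
  calc ∫ y, jarzynskiEstimate w y ∂πS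
      ≤ ∫ y, (∑ j : Fin (N + 1), jarzynskiEstimate w (j.removeNth y)) / (N + 1 : ℕ) ∂πS :=
        integral_mono hestS hRHS fun y => jarzynskiEstimate_le_avg_leaveOneOut hwpos hN y
    _ = (∑ j : Fin (N + 1), ∫ y, jarzynskiEstimate w (j.removeNth y) ∂πS) / (N + 1 : ℕ) := by
        rw [integral_div, integral_finsetSum _ hI]
    _ = (∑ _j : Fin (N + 1), ∫ z, jarzynskiEstimate w z ∂πN) / (N + 1 : ℕ) := by
        congr 1
        refine sum_congr rfl fun j _ => ?_
        exact integral_comp_removeNth_pi μ j (measurable_jarzynskiEstimate hwm N).aestronglyMeasurable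
    _ = ∫ z, jarzynskiEstimate w z ∂πN := by
        rw [sum_const, card_univ, Fintype.card_fin, nsmul_eq_mul]
        field_simp

/-- **The bias is monotone over any number of extra evolutions**: `E[ΔF̂_M] ≤ E[ΔF̂_N]` for
`1 ≤ N ≤ M` (logarithms of the sample means integrable at every sample size from `N` on). -/
theorem integral_jarzynskiEstimate_antitone (μ : Measure E) [IsProbabilityMeasure μ] {w : E → ℝ}
    (hwm : Measurable w) (hwpos : ∀ a, 0 < w a) {N M : ℕ} (hN : 0 < N) (hNM : N ≤ M)
    (hlog : ∀ n, N ≤ n →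
      Integrable (fun y : Fin n → E => Real.log (sampleMean w y)) (Measure.pi fun _ : Fin n => μ)) :
    ∫ y, jarzynskiEstimate w y ∂(Measure.pi fun _ : Fin M => μ) ≤
      ∫ z, jarzynskiEstimate w z ∂(Measure.pi fun _ : Fin N => μ) := by
  induction M, hNM using Nat.le_induction with
  | base => exact le_rfl
  | succ M hNM ih =>
      exact (integral_jarzynskiEstimate_succ_le μ hwm hwpos (lt_of_lt_of_le hN hNM)
        (hlog M hNM) (hlog (M + 1) (Nat.le_succ_of_le hNM))).trans ih

/-- **The delete-one jackknife acts against the bias**: its expectation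
`(N+1)·E[ΔF̂_{N+1}] − N·E[ΔF̂_N]` is `≤ E[ΔF̂_{N+1}]` (`N ≥ 1`). -/
theorem jackknife_integral_le (μ : Measure E) [IsProbabilityMeasure μ] {w : E → ℝ}
    (hwm : Measurable w) (hwpos : ∀ a, 0 < w a) {N : ℕ} (hN : 0 < N)
    (hlogN : Integrable (fun y : Fin N → E => Real.log (sampleMean w y)) (Measure.pi fun _ : Fin N => μ))
    (hlogS : Integrable (fun y : Fin (N + 1) → E => Real.log (sampleMean w y))
      (Measure.pi fun _ : Fin (N + 1) => μ)) :
    ((N + 1 : ℕ) : ℝ) * ∫ y, jarzynskiEstimate w y ∂(Measure.pi fun _ : Fin (N + 1) => μ) -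
        (N : ℝ) * ∫ z, jarzynskiEstimate w z ∂(Measure.pi fun _ : Fin N => μ) ≤
      ∫ y, jarzynskiEstimate w y ∂(Measure.pi fun _ : Fin (N + 1) => μ) := by
  have h := integral_jarzynskiEstimate_succ_le μ hwm hwpos hN hlogN hlogS
  have hNr : (0 : ℝ) < N := by exact_mod_cast hN
  push_cast
  nlinarith

/-! ## For a Crooks pair: the estimate over-estimates `ΔF` -/

namespace CrooksPair

variable {Ω : Type*} [MeasurableSpace Ω]
variable {ν₀ ν₁ : Measure Ω} {κF κR : Kernel Ω E} {s e : E → Ω} {W : E → ℝ}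

/-- **`ΔF ≤ E[ΔF̂_N]` for every Crooks pair and every `N ≥ 1`.**  `N` independent forward evolutions
from prior equilibrium (law `P_F^{⊗N}`), the estimate `ΔF̂_N = −log ((1/N) Σ_i e^{−W_i})`: its mean
is at least `ΔF` (`= −log E_{P_F}[e^{−W}]`, Jarzynski), provided `log` of the sample mean is
integrable. -/
theorem freeEnergyDiff_le_integral_jarzynskiEstimate [IsFiniteMeasure ν₀] [IsFiniteMeasure ν₁]
    [IsMarkovKernel κF] [IsMarkovKernel κR] (h0 : ν₀ univ ≠ 0) (h : CrooksPair ν₀ ν₁ κF κR s e W)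
    {ΔF : ℝ} (hΔF : Real.exp (-ΔF) = ((ν₀ univ)⁻¹ * ν₁ univ).toReal) {N : ℕ} (hN : 0 < N)
    (hlog : Integrable (fun y : Fin N → E => Real.log (sampleMean (fun ε => Real.exp (-W ε)) y))
      (Measure.pi fun _ : Fin N => fwdPathLaw ν₀ κF)) :
    ΔF ≤ ∫ y, jarzynskiEstimate (fun ε => Real.exp (-W ε)) y
      ∂(Measure.pi fun _ : Fin N => fwdPathLaw ν₀ κF) := by
  haveI := isProbabilityMeasure_fwdPathLaw ν₀ h0 κF
  have key := neg_log_integral_le_integral_jarzynskiEstimate (fwdPathLaw ν₀ κF)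
    (w := fun ε => Real.exp (-W ε)) (fun ε => Real.exp_pos _) (h.integrable_exp_neg_work h0) hN hlog
  rwa [h.integral_exp_neg_work, ← hΔF, Real.log_exp, neg_neg] at key

/-- **… and by less for more evolutions**: `E[ΔF̂_{N+1}] ≤ E[ΔF̂_N]` for every Crooks pair
(`N ≥ 1`, logarithms of the sample means integrable). -/
theorem integral_jarzynskiEstimate_succ_le [IsFiniteMeasure ν₀] [IsMarkovKernel κF]
    (h0 : ν₀ univ ≠ 0) (h : CrooksPair ν₀ ν₁ κF κR s e W) {N : ℕ} (hN : 0 < N)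
    (hlogN : Integrable (fun y : Fin N → E => Real.log (sampleMean (fun ε => Real.exp (-W ε)) y))
      (Measure.pi fun _ : Fin N => fwdPathLaw ν₀ κF))
    (hlogS : Integrable (fun y : Fin (N + 1) → E => Real.log (sampleMean (fun ε => Real.exp (-W ε)) y))
      (Measure.pi fun _ : Fin (N + 1) => fwdPathLaw ν₀ κF)) :
    ∫ y, jarzynskiEstimate (fun ε => Real.exp (-W ε)) y
        ∂(Measure.pi fun _ : Fin (N + 1) => fwdPathLaw ν₀ κF) ≤
      ∫ z, jarzynskiEstimate (fun ε => Real.exp (-W ε)) z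
        ∂(Measure.pi fun _ : Fin N => fwdPathLaw ν₀ κF) := by
  haveI := isProbabilityMeasure_fwdPathLaw ν₀ h0 κF
  exact GeneralNCMC.integral_jarzynskiEstimate_succ_le (fwdPathLaw ν₀ κF)
    (w := fun ε => Real.exp (-W ε))
    (Real.measurable_exp.comp h.measurable_W.neg) (fun ε => Real.exp_pos _) hN hlogN hlogS

end CrooksPair

end Summit.Ventures.LatticeQCDFlow.Exactness.GeneralNCMC
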